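import Summits.AnomalousDissipation.AnomalousDissipation.Theorems.BaireTransferRobustLoudUpgradeStubBorderedConeA
import Literature.Analysis.FunctionSpaces.TorusCalculusProofs
import Literature.Analysis.FunctionSpaces.TorusFourierCalculus
import Literature.Analysis.FunctionSpaces.TorusSpaceTime
import Literature.Analysis.FluidPDE.LongTimeAveragePeriodic

/-!
# Stub `stub_borderedCone` of the line `malkin-cone-group-orbits` (crux stmt-AnomalousDissipation-1144):
# `borderedSteady S a E ε ⊆ closure (interior (loud S a E ε))`

Registered signature (proved here, textually):
`theorem stub_borderedCone : ∀ (S : Finset (Fin 3 → ℤ)) (a E ε : ℝ),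
borderedSteady S a E ε ⊆ closure (interior (loud S a E ε))`.

Part A (`…StubBorderedConeA.lean`) proved the abstract Malkin cone `mem_closure_interior_of_bordered` for any
set `A ⊆ P_S` that is a union of `T³`-orbits of the phase action.  Here (§5) `LOUD` is shown to be such a union
(space translation of the classical witness: `f_{b·e} = f_e(· + b)`, pattern of
`Cruxes/RobustLoudUpgrade/Disproof.lean` §11, re-proved because a crux work file is not importable), a classical
steady state with budgets is a (`1`-periodic) loud witness (pattern of Disproof.lean §6), and (§6) the class
`borderedSteady` — a `dir`-invariant `c`, a `dir`-breaking `d`, and the bordered persistence data `(ℓ, σ, r₀)`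
with corrected forces `f_{c' − σ(c') d}` carrying steady states with budgets — is fed into the cone.
Pure proof file (no definitions).  References: Vanderbauwhede 1982 Ch. 8; Dancer 1984; the vocabulary module
`Theorems/BaireTransferRobustLoudUpgradeLine.lean` (§6, reshape v3).
-/

-- `Summit.<Summit>.<Problem>` is the tree's mandated summit-side namespace (CONVENTIONS §2); for this
-- single-conjunct summit the two coincide, so the duplicate is deliberate.
set_option linter.dupNamespace false

noncomputable section

open scoped BigOperators Topology
open Filter Set Function TopologicalSpace MeasureTheory

namespace Summit.AnomalousDissipation.AnomalousDissipation.Theorems.RobustLoudUpgrade.BorderedCone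

open Literature.Analysis.FunctionSpaces Literature.Analysis.FunctionSpaces.Torus
open Literature.Analysis.FluidPDE
open Summit.AnomalousDissipation.AnomalousDissipation.Theses.BaireTransfer
open UnitAddTorus

/-- The flat unit torus `T³`. -/
local notation "𝕋³" => UnitAddTorus (Fin 3)
/-- Real velocity values. -/
local notation "ℝ³" => EuclideanSpace ℝ (Fin 3)

/-- The phase action of `b ∈ T³` on `P_S`: `(b·e) k = e_k(b) • e k` (notation for a lambda term). -/
local notation "phase[" b "] " e:arg => (fun k => mFourier (Subtype.val k) b • e k)

/-- The lattice flow point `θ·dir (mod ℤ³) ∈ T³` (notation for a lambda term). -/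
local notation "flow[" dir "] " θ:arg =>
  (fun i : Fin 3 => ((((θ : ℝ) * ((dir : Fin 3 → ℤ) i : ℝ) : ℝ)) : UnitAddCircle))

variable {S : Finset (Fin 3 → ℤ)}

/-! ## §5 `LOUD` is a union of `T³`-orbits, and steady states with budgets are loud
(patterns from Cruxes/RobustLoudUpgrade/Disproof.lean §11 and §6, re-proved here because a work file is not
importable) -/

section Translate

/-- Re-centred lifts commute with translations. [folklore] -/
theorem liftAt_comp_add_right' {F : Type*} (f : 𝕋³ → F) (b x : 𝕋³) :
    liftAt (fun y => f (y + b)) x = liftAt f (x + b) := by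
  funext v
  simp only [liftAt_apply, add_right_comm]

/-- The torus Laplacian commutes with translations. [folklore] -/
theorem laplacian_comp_add_right' {F : Type*} [NormedAddCommGroup F] [InnerProductSpace ℝ F]
    (f : 𝕋³ → F) (b x : 𝕋³) : Torus.laplacian (fun y => f (y + b)) x = Torus.laplacian f (x + b) := by
  simp only [Torus.laplacian, liftAt_comp_add_right']

/-- The torus gradient commutes with translations. [folklore] -/
theorem gradient_comp_add_right' (f : 𝕋³ → ℝ) (b x : 𝕋³) :
    Torus.gradient (fun y => f (y + b)) x = Torus.gradient f (x + b) := by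
  simp only [Torus.gradient, liftAt_comp_add_right']

/-- The torus Fréchet derivative commutes with translations. [folklore] -/
theorem fderiv_comp_add_right' {F : Type*} [NormedAddCommGroup F] [NormedSpace ℝ F] (f : 𝕋³ → F)
    (b x : 𝕋³) : Torus.fderiv (fun y => f (y + b)) x = Torus.fderiv f (x + b) := by
  simp only [Torus.fderiv, liftAt_comp_add_right']

/-- The convective derivative commutes with translations. [folklore] -/
theorem convect_comp_add_right' {F : Type*} [NormedAddCommGroup F] [NormedSpace ℝ F] (u : 𝕋³ → ℝ³)
    (v : 𝕋³ → F) (b x : 𝕋³) :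
    Torus.convect (fun y => u (y + b)) (fun y => v (y + b)) x = Torus.convect u v (x + b) := by
  simp only [Torus.convect, fderiv_comp_add_right']

/-- Partial derivatives commute with translations. [folklore] -/
theorem partialDeriv_comp_add_right' {F : Type*} [NormedAddCommGroup F] [NormedSpace ℝ F] (i : Fin 3)
    (f : 𝕋³ → F) (b x : 𝕋³) : partialDeriv i (fun y => f (y + b)) x = partialDeriv i f (x + b) := by
  simp only [Torus.partialDeriv, Torus.lineDeriv, add_right_comm]

/-- The divergence commutes with translations. [folklore] -/
theorem divergence_comp_add_right' (u : 𝕋³ → ℝ³) (b x : 𝕋³) :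
    divergence (fun y => u (y + b)) x = divergence u (x + b) := by
  simp only [divergence]
  refine Finset.sum_congr rfl fun i _ => ?_
  exact partialDeriv_comp_add_right' i (fun y => u y i) b x

/-- Joint smoothness is preserved by space translations. [folklore] -/
theorem isSmoothSpaceTimeOn_comp_add_right {F : Type*} [NormedAddCommGroup F] [NormedSpace ℝ F]
    {T : Set ℝ} {u : ℝ → 𝕋³ → F} (hu : Torus.IsSmoothSpaceTimeOn T u) (b : 𝕋³) :
    Torus.IsSmoothSpaceTimeOn T (fun t y => u t (y + b)) := by
  obtain ⟨w, rfl⟩ := proj_surjective b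
  have hst : stLift (fun t y => u t (y + proj w)) =
      stLift u ∘ fun z : ℝ × EuclideanSpace ℝ (Fin 3) => (z.1, z.2 + w) := by
    funext z
    simp only [Function.comp_apply, stLift, proj_add]
  unfold Torus.IsSmoothSpaceTimeOn at hu ⊢
  rw [hst]
  refine hu.comp ((contDiff_fst.prodMk (contDiff_snd.add contDiff_const)).contDiffOn) ?_
  rintro ⟨t, y⟩ hz
  exact mk_mem_prod (mem_prod.1 hz).1 (mem_univ _)

/-- **Space translation of a classical solution** (steady force): `(u,p)(t, · + b)` solves NS_ν forced
by `f(· + b)`. [folklore] -/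
theorem translate_isClassical {ν : ℝ} {f : 𝕋³ → ℝ³} {u : ℝ → 𝕋³ → ℝ³} {p : ℝ → 𝕋³ → ℝ}
    (h : IsClassicalNSSolutionOn univ ν (fun _ => f) u p) (b : 𝕋³) :
    IsClassicalNSSolutionOn univ ν (fun _ y => f (y + b)) (fun t y => u t (y + b))
      (fun t y => p t (y + b)) where
  smooth_velocity := isSmoothSpaceTimeOn_comp_add_right h.smooth_velocity b
  smooth_pressure := isSmoothSpaceTimeOn_comp_add_right h.smooth_pressure b
  momentum t _ x := by
    have hm := h.momentum t (mem_univ _) (x + b)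
    have h1 : Torus.timeDerivWithin univ (fun t y => u t (y + b)) t x =
        Torus.timeDerivWithin univ u t (x + b) := rfl
    rw [h1, convect_comp_add_right', laplacian_comp_add_right', gradient_comp_add_right']
    exact hm
  divFree t _ x := by
    rw [divergence_comp_add_right']
    exact h.divFree t (mem_univ _) (x + b)

/-- Mean energy is translation invariant. [folklore] -/
theorem meanEnergy_translate (u : ℝ → 𝕋³ → ℝ³) (b : 𝕋³) :
    meanEnergy (fun t y => u t (y + b)) = meanEnergy u := by
  rw [meanEnergy_eq_longTimeAvgSup, meanEnergy_eq_longTimeAvgSup]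
  congr 1
  funext t
  exact integral_add_right_eq_self (μ := (volume : Measure 𝕋³)) (fun y => ‖u t y‖ ^ 2) b

/-- `gradNormSq` is translation invariant. [folklore] -/
theorem gradNormSq_translate (v : 𝕋³ → ℝ³) (b : 𝕋³) :
    gradNormSq (fun y => v (y + b)) = gradNormSq v := by
  unfold gradNormSq
  have h : (fun x => ∑ i, ‖partialDeriv i (fun y => v (y + b)) x‖ ^ 2) =
      fun x => (fun z => ∑ i, ‖partialDeriv i v z‖ ^ 2) (x + b) := by
    funext x
    simp only [partialDeriv_comp_add_right']
  rw [h]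
  exact integral_add_right_eq_self (μ := (volume : Measure 𝕋³)) (fun z => ∑ i, ‖partialDeriv i v z‖ ^ 2) b

/-- Mean dissipation of a jointly smooth field is translation invariant. [folklore] -/
theorem meanDissipation_translate {ν : ℝ} {u : ℝ → 𝕋³ → ℝ³} (hu : Torus.IsSmoothSpaceTimeOn univ u)
    (b : 𝕋³) : meanDissipation ν (fun t y => u t (y + b)) = meanDissipation ν u := by
  unfold meanDissipation
  congr 1
  funext t
  have hs : IsSmooth (u t) := hu.isSmooth_slice (mem_univ t)
  have hsb : IsSmooth (fun y => u t (y + b)) := hs.comp_add_right b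
  rw [← gradNormSq_eq_toReal_eGradNormSq_holds hs, ← gradNormSq_eq_toReal_eGradNormSq_holds hsb,
    gradNormSq_translate]

variable {a E ε : ℝ}

/-- **`LOUD` is a union of `T³`-orbits** (one direction of Disproof.lean `mem_loud_iff_phase`):
`b·e ∈ LOUD → e ∈ LOUD`, by translating the witness by `−b`. [folklore] -/
theorem mem_loud_of_phase_mem (b : 𝕋³) (e : Coeff S) (h : phase[b] e ∈ loud S a E ε) :
    e ∈ loud S a E ε := by
  obtain ⟨ν, hν, hνa, τ, u, p, hτ, hsol, hper, hE, hε⟩ := h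
  refine ⟨ν, hν, hνa, τ, fun t y => u t (y + -b), fun t y => p t (y + -b), hτ, ?_, fun t => ?_, ?_, ?_⟩
  · have key := translate_isClassical hsol (-b)
    rw [force_phase] at key
    simp only [neg_add_cancel_right] at key
    exact key
  · funext y; simp only [hper t]
  · rwa [meanEnergy_translate]
  · rwa [meanDissipation_translate hsol.smooth_velocity]

/-- **A classical steady state at a viscosity `ν ∈ (0,a)` with budgets `(E, ε)` is a loud witness**
(`1`-periodic in time; pattern from Disproof.lean §6 `cLam_mem_loud`). [folklore] -/
theorem mem_loud_of_steady {ν : ℝ} (hν : 0 < ν) (hνa : ν < a) {e : Coeff S} {u' : 𝕋³ → ℝ³} {p' : 𝕋³ → ℝ}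
    (hst : Torus.IsSteadyNSState ν (force S e) u' p') (hE : meanEnergy (fun _ : ℝ => u') ≤ E)
    (hε : ε ≤ meanDissipation ν (fun _ : ℝ => u')) : e ∈ loud S a E ε :=
  ⟨ν, hν, hνa, 1, fun _ => u', fun _ => p', one_pos, hst, fun _ => rfl, hE, hε⟩

end Translate

/-! ## §6 Assembly: the registered stub

`borderedSteady` (vocabulary module §6) is, verbatim, the hypothesis list of `mem_closure_interior_of_bordered`
with `A = loud S a E ε` at one viscosity `ν ∈ (0,a)`, the corrected forces carrying classical steady states with
budgets `≤ E`, `≥ ε`; §5 supplies the two facts about `LOUD` (union of orbits; steady states are loud). -/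

section Assembly

variable {a E ε : ℝ}

/-- **The Goldstone circle**: translating a classical steady state of a `dir`-invariant force along the flow
of `dir` gives classical steady states of the SAME force. [folklore] -/
theorem isSteadyNSState_translate_of_mem_invariantAlong {dir : Fin 3 → ℤ} {c : Coeff S}
    (hc : c ∈ invariantAlong S dir) {ν : ℝ} {u₀ : 𝕋³ → ℝ³} {p₀ : 𝕋³ → ℝ}
    (h : Torus.IsSteadyNSState ν (force S c) u₀ p₀) (θ : ℝ) :
    Torus.IsSteadyNSState ν (force S c) (fun y => u₀ (y + flow[dir] θ)) (fun y => p₀ (y + flow[dir] θ)) := by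
  have key := translate_isClassical h (flow[dir] θ)
  simp only [force_flow_of_mem_invariantAlong hc] at key
  exact key

end Assembly

/-- **Stub `stub_borderedCone` of the line `malkin-cone-group-orbits`**: the bordered class lies in
`closure (interior LOUD)` — the abstract Malkin cone `mem_closure_interior_of_bordered` (part A) with
`A = LOUD` (a union of `T³`-orbits, §5) and the loudness of steady states with budgets. [folklore] -/
theorem stub_borderedCone : ∀ (S : Finset (Fin 3 → ℤ)) (a E ε : ℝ), borderedSteady S a E ε ⊆ closure (interior (loud S a E ε)) := by
  rintro S a E ε c ⟨ν, hν, hνa, dir, d, ℓ, σ, r₀, hc, hd, hℓ, hσc, hσ, hr₀, hcont, hpers⟩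
  refine mem_closure_interior_of_bordered (A := loud S a E ε) (fun b e h => mem_loud_of_phase_mem b e h)
    hc hd hσc hσ hℓ hr₀ hcont fun c' hc' => ?_
  obtain ⟨u', p', hst, hE, hε⟩ := hpers c' hc'
  exact mem_loud_of_steady hν hνa hst hE hε

end Summit.AnomalousDissipation.AnomalousDissipation.Theorems.RobustLoudUpgrade.BorderedCone

end
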